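import Literature.Computability.FineGrained.FineGrainedWave0S04Reduction
import Literature.Computability.FineGrained.IPRenameCost
import HarnessLib

/-!
# Impagliazzo–Paturi's Lemma 2, Theorem 3 and its consequence: the discharges

Family `fine-grained` (trunk T-CPLX-FINE); sibling proof file of `KSatExponentGap.lean` and
`FineGrainedWave0.lean` (D-0014). The named facts

* `impagliazzoPaturi_lemma2` (`KSatExponentGap.lean`; Impagliazzo–Paturi, JCSS 62 (2001),
  Lemma 2, p. 373),
* `ETH.frequently_satExponent_lt` (`FineGrainedWave0.lean`, **fine-grained.S04**, consequence:
  assuming ETH, `(s_k)` increases infinitely often; abstract and p. 369)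

are PROVED here (and Theorem 3, `satExponent_le_satExponentLimit`, fine-grained.S04, p. 374:
`s_k ≤ (1 - d/k) s_∞`, follows from the first by `satExponent_le_satExponentLimit_of_lemma2`,
`KSatExponentGapProofs.lean`), by plugging the last machine fact of the assembly — the renaming
machine
`ipRename_reduceList_computable` (`IPLemma2Assembly.lean`; the "Moreover" sentence of Lemma 2),
now the theorem `IPRenameM.ipRename_reduceList_computable_holds'` of `IPRenameCost.lean` — into
the one-hypothesis reductions of `FineGrainedWave0S04Reduction.lean`
(`impagliazzoPaturi_lemma2_of_ipRename`, `satExponent_le_satExponentLimit_of_ipRename`,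
`ETH.frequently_satExponent_lt_of_ipRename`), which already consume the other ingredients as
theorems: the sparsification algorithm (`sparsification_holds`, `SparsificationAlgorithm.lean`),
the compaction machine (`Compaction.kCNF_compact_computable_holds`, `CompactionMachine.lean`),
brute-force k-SAT (`kSATInExpTime_one_holds`, `SATBruteForceMachine.lean`) and the exhaustive
search of light assignments (`lightKSAT_exhaustiveSearch_holds`, `LightSatMachine.lean`).
This file is a new leaf module (nothing imports it), so the two import chains it joins
(`… → KSatExponentGapProofs → FineGrainedWave0S04Reduction` and
`… → IPLemma2MachineLift → IPRenameMain → IPRenameCost`) stay acyclic. No new facts are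
introduced; no statement is changed.

## References

* R. Impagliazzo, R. Paturi, *On the complexity of k-SAT*, J. Comput. System Sci. 62 (2001)
  367–375, doi:10.1006/jcss.2000.1727: Lemma 2 (p. 373), Theorem 3 (p. 374), abstract and
  p. 369 (the consequence "`s_k` is increasing infinitely often assuming ETH").
  [key `ImpagliazzoPaturiJCSS2001`] Conference version: *Complexity of k-SAT*, Proc. 14th IEEE
  CCC (1999) 237–240, doi:10.1109/ccc.1999.766282, Theorem 2 and Theorem 3.
* R. Impagliazzo, R. Paturi, F. Zane, *Which problems have strongly exponential complexity?*,
  J. Comput. System Sci. 63 (2001) 512–530, Theorem 1 / Corollary 1 (sparsification).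
-/

namespace Literature.Computability.FineGrained

/-- **Impagliazzo–Paturi 2001, Lemma 2** (discharge of the named fact
`impagliazzoPaturi_lemma2`): for `k ≥ 3` and `δ, ε > 0` there are `k'`, `C` and a reduction
`F : KCNF k → List (KCNF k')`, computable in time `2^{2εn} · poly(L)`, producing at most
`C · 2^{2εn} · (L+1)^C` formulas, each on at most `(1 - δ/(3k)) n` variables and of size
`≤ C (L+1)^C`, whose disjunction is equisatisfiable with `φ` whenever `φ` has no satisfying
assignment with fewer than `δ n` ones. Proof: the sparsification algorithm
(`sparsification_holds`), the compaction machine and the renaming machine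
(`IPRenameM.ipRename_reduceList_computable_holds'`), assembled by
`IPLemma2.impagliazzoPaturi_lemma2_of` (`IPLemma2Assembly.lean`).
[cite: ImpagliazzoPaturiJCSS2001, Lemma 2 (p. 373)] -/
theorem impagliazzoPaturi_lemma2_holds : impagliazzoPaturi_lemma2 :=
  impagliazzoPaturi_lemma2_of_ipRename IPRenameM.ipRename_reduceList_computable_holds'

/-- **fine-grained.S04, consequence** (discharge of the named fact
`ETH.frequently_satExponent_lt`): assuming ETH, the sequence `(s_k)` of k-SAT exponents increases
infinitely often. Proof: Theorem 3 (from Lemma 2,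
`satExponent_le_satExponentLimit_of_lemma2`) and the brute-force bound
`kSATInExpTime_one_holds`, via `ETH.frequently_satExponent_lt_of` (`FineGrainedWave0Proofs.lean`),
packaged as `ETH.frequently_satExponent_lt_of_ipRename`.
[cite: ImpagliazzoPaturiJCSS2001, abstract and p. 369 (unnumbered consequence of Theorem 3)] -/
theorem ETH.frequently_satExponent_lt_holds : ETH.frequently_satExponent_lt :=
  ETH.frequently_satExponent_lt_of_ipRename IPRenameM.ipRename_reduceList_computable_holds'

end Literature.Computability.FineGrained
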